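import Literature.AlgebraicGeometry.HodgeTheory.WeilClassesFieldDecomposableOfDivisorForm
import Literature.AlgebraicGeometry.Milne1999.LefschetzCentraliserBiproducts
import Literature.AlgebraicGeometry.Pohlmann1968.HodgeClassesCMTypeProducts
import HarnessLib

/-!
# Weil classes on `A ⊗ F` — the power `A^{[F:ℚ]}` with `F` acting on the multiplicity space — are PRODUCTS OF DIVISOR
# CLASSES, hence algebraic, for every complex abelian variety `A` and every number field `F` (Moonen–Zarhin 1998 §1,
# Criterion (2), the case `F ⊆ M_N(ℚ) ⊆ B`; Deligne's `A₀ ⊗ E`)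

Layer `Literature/AlgebraicGeometry/HodgeTheory`; THEOREMS ONLY — no definition, no named fact, sorry-free (D-0026,
net debt 0). Sequel of the seat's `WeilClassesFieldDecomposableOfDivisorForm` (the divisor-form criterion and its §6
PROJECTION CRITERION `weilClassesField_le_divisorClassesSpan_of_symm_idempotent`), which it feeds with the coordinate
projector of a power; built on the tree's biproduct calculus on `H¹` (`Pohlmann1968/HodgeClassesCMTypeProducts`:
`H¹(⨁ Aⱼ) = ⊕ πⱼ^* H¹(Aⱼ)`) and Milne's product polarization (`Milne1999/LefschetzCentraliserBiproducts`:
`sumPolarizationClass`, its hypotheses and the block form of `Q_D`).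

## The print

B. J. J. Moonen, Yu. G. Zarhin, *Weil classes on abelian varieties*, J. reine angew. Math. **496** (1998) =
arXiv:alg-geom/9612017 [MoonenZarhin1998WeilClasses] (held text `paper:arxiv-alg-geom_9612017`), §1. With `S_λ` the
`†`-symmetric elements of `End⁰(X)`, `B` the subalgebra they generate and `G_div(X) = Gl_B(V) ∩ SP(V, φ)` (chunk p0002
L54–L66), Criterion (2) (chunk p0003 L46–L50): «if `F ⊆ B` and `G_div(X) ⊆ Sl_F(V_X)` then all classes in `W_F` are
decomposable», proved through the divisor forms «`φ_s : (v₁, v₂) ↦ φ(s · v₁, v₂)` for `s ∈ S_λ`» (chunk p0002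
L72–L76); and the Theorem (chunk p0003 L60–L90): for `X` isogenous to a power `Y^m` of a simple abelian variety and
`F ↪ End⁰(X)` a subfield with `W_F` Hodge, «either all classes in `W_F` are decomposable, or all non-zero classes in
`W_F` are exceptional», the latter exactly in the listed cases of Type 3 / Type 4 — in particular (proof, chunk p0003
L81–L88) «suppose that `F ⊆ B` … In the cases we are considering [Types 1, 2], the group `G_div(X)` is connected and
semi-simple, so `G_div(X) ⊆ Sl_F(V_X)`, hence `G_div(X)` acts trivially on `W_F`.»  The construction `A ⊗ F`:
P. Deligne, *Hodge cycles on abelian varieties*, LNM 900 (1982) [Deligne1982HodgeCycles], §4 (4.4)–(4.5) («`A₀ ⊗_ℚ E`»,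
`E` acting through the second factor, `H¹(A₀ ⊗ E) = H¹(A₀) ⊗ E`).

## The carrier and what is proved

`A` a complex abelian variety (`Motives.AbelianVariety ℂ`), `X = ⨁ (fun _ : Fin (n + 1) ↦ A) = A^{n+1}` (Mathlib's
biproduct of the constant family), `πᵢ`, `ιᵢ` its projections and inclusions; `h ∈ H²(A(ℂ); ℂ)` with the
three standing hypotheses of the tree's polarization calculus (`h ∈ B¹(A) ⊗ ℂ`, `h^{dim A} ≠ 0`, `Q_h` non-degenerate
on `H¹`, `0 < dim A`), and `D = Σᵢ πᵢ^* h = Milne1999.sumPolarizationClass (fun _ ↦ A) (fun _ ↦ h)` the product polarization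
class on `X` (Milne 1999 §1 p. 643). An endomorphism `φ : X ⟶ X` HAS THE INTEGER MATRIX `α ∈ M_{n+1}(ℤ)` when
`φ ≫ πᵢ = Σⱼ αᵢⱼ πⱼ` for all `i` (e.g. `φ = biproduct.lift (i ↦ Σⱼ αᵢⱼ πⱼ)`); `F = ℚ[T]/(P) = ℚ(α)` for `P ∈ ℤ[T]`
monic, irreducible over `ℚ`, of degree `n + 1`, with `P(α) = 0` (e.g. `P = χ_α` irreducible) — this is `A ⊗_ℤ Λ` for the
`ℤ[T]/(P)`-lattice `Λ = ℤ^{n+1}`, `T ↦ α`. On the carrier, `W_F ⊗ ℂ = weilClassesField X φ P (2 dim A)`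
(`= ⊕_{P(ρ)=0} ⋀^{2 dim A} V_ρ`, `V_ρ = ker(φ^* − ρ) ⊆ H¹(X(ℂ); ℂ)`), `𝒟^m ⊗ ℂ = divisorClassesSpan X.X (dim X) m`,
`S_λ ⊗ ℂ = symmetricPullbackSpan X D`, `B ⊗ ℂ = Algebra.adjoin ℂ (S_λ ⊗ ℂ)`.

* §1 MATRIX CALCULUS ON `End(A^{n+1})` (Mumford §19): `biproduct_comp_comp_π_of_matrix` (composition multiplies
  matrices), `biproduct_eval₂_comp_π_of_matrix` (`P(φ)` has matrix `P(α)`), **`biproduct_eval₂_eq_zero_of_matrix`**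
  (`P(α) = 0 ⟹ P(φ) = 0` in `End X`), `biproduct_lift_sum_zsmul_π_comp_π`, `biproduct_eq_sum_zsmul_π_comp_ι_of_matrix`
  (`φ = Σᵢⱼ αᵢⱼ (πⱼ ≫ ιᵢ)`).
* §2 PULL-BACKS ON `H¹(X) = ⊕ πᵢ^* H¹(A)`: `pullbackOne_map_π_of_matrix` (`φ^* πᵢ^* a = Σⱼ αᵢⱼ πⱼ^* a`),
  `pullbackOne_eq_sum_of_matrix`, `sum_smul_map_ι_eq_of_mem_eigenspace_of_matrix` (the components of a
  `ρ`-eigenvector of `φ^*` satisfy `Σᵢ αᵢⱼ vᵢ = ρ vⱼ`), `sum_smul_map_π_mem_eigenspace_of_matrix` (the graph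
  `u_ℓ(a) = Σ ℓᵢ πᵢ^* a` of a row eigenvector `ℓ α = ρ ℓ` lies in `V_ρ`),
  `exists_rowEigenvector_of_eigenspace_ne_bot_of_matrix` (`V_ρ ≠ 0 ⟹` a row eigenvector `ℓ ≠ 0` exists — a linear
  functional applied to the components of an eigenvector; no characteristic-polynomial theory is used), and
  **`exists_eq_sum_smul_map_π_of_mem_eigenspace_of_matrix`**: `V_ρ = u_ℓ(H¹(A))` (injectivity of `u_ℓ` and the tree's
  dimension count `dim V_ρ = 2 dim A`, `finrank_eigenspace_eq_of_root`).
* §3 THE PRODUCT POLARIZATION: `dim_biproduct_const_succ` (`dim A^{n+1} = (n+1) dim A`),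
  `polarizationPairingOne_sum_map_π_left/right` (`Q_D(πₐ^* c, y) = Q_D(πₐ^* c, πₐ^* yₐ)`), and
  **`polarizationPairingOne_sum_map_π_map_π_eq_of_const`** — THE DIAGONAL BLOCKS OF `Q_D` COINCIDE,
  `Q_D(πᵢ^* a, πᵢ^* b) = Q_D(πⱼ^* a, πⱼ^* b)`: the transposition `σ` of two factors has `σ^* D = D`, so
  `Q_D(σ^* x, σ^* y) = σ^* Q_D(x, y)` (naturality of cup products), and `σ^*` is the identity on the top-degree line,
  which is spanned by `D^{dim X} ≠ 0`, a class it fixes.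
* §4 `M_{n+1}(ℚ) ⊆ B`: `pullbackOne_π_comp_ι_self_mem_symmetricPullbackSpan` (`(πₐ ≫ ιₐ)^* ∈ S_λ ⊗ ℂ`),
  `pullbackOne_π_comp_ι_add_mem_symmetricPullbackSpan` (`(πₐ ≫ ι_b + π_b ≫ ιₐ)^* ∈ S_λ ⊗ ℂ`),
  `pullbackOne_π_comp_ι_mem_adjoin_symmetricPullbackSpan` (every matrix unit `(πₐ ≫ ι_b)^* ∈ B ⊗ ℂ`, as
  `e_{ab} = e_{aa}(e_{ab} + e_{ba})`), **`pullbackOne_mem_adjoin_symmetricPullbackSpan_of_matrix`** (`F ⊆ B ⊗ ℂ`).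
* §5 **`weilClassesField_biproduct_le_divisorClassesSpan_of_matrix`** — `W_F(A ⊗ F) ⊗ ℂ ≤ 𝒟^{dim A}(A^{n+1}) ⊗ ℂ`;
  **`weilClassesField_biproduct_le_algebraicClasses_of_matrix`** — `≤` the algebraic classes (Lefschetz (1,1),
  `lefschetzOneOne_rational_holds`); and the versions `…_of_irreducible_charpoly` for `φ_α = lift (i ↦ Σⱼ αᵢⱼ πⱼ)`,
  `P = χ_α` (Cayley–Hamilton), whose only hypotheses are the four on `(A, h)` and the irreducibility of `χ_α` over `ℚ`.
  The proof of §5 is the print's: `F ⊆ B` (§4) and the divisor form `φ_s` of the symmetric idempotent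
  `s = (π_{i₀} ≫ ι_{i₀})^*`, `i₀` an index with `ℓ_{i₀} ≠ 0`, is non-degenerate on `V_ρ = u_ℓ(H¹(A))` because `s` is
  injective there (`s u_ℓ(a) = ℓ_{i₀} π_{i₀}^* a`) with `s(V_ρ) = π_{i₀}^* H¹(A) = s(H¹(X))` — the hypotheses `hinj`,
  `hsurj` of the projection criterion — at ONE root `ρ` («one root suffices»).
* §6 (rider) **`eigenMultiplicity_biproduct_eq_dim_of_matrix`** — `(A ⊗ F, F)` IS OF WEIL TYPE: at every complex root `ρ`
  of `P` the multiplicity `n_ρ = dim (V_ρ ∩ H^{1,0}(A^{n+1}))` equals `dim A` (half of `dim V_ρ`), because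
  `V_ρ ∩ H^{1,0} = u_ℓ(H^{1,0}(A))` (pull-backs preserve Hodge types, `ι_{i₀}^* ∘ u_ℓ = ℓ_{i₀} · id`); and
  `eigenMultiplicity_biproduct_eq_dim_of_irreducible_charpoly`. (Moonen–Zarhin's condition (6) `n_σ = n_σ'`; Deligne's
  (4.4) at `A₀ ⊗ E`.)

Relation to the tree's TENSOR-POINT cluster (seat `lit-andre-2`: `HodgeTheory/WeilClassesTensorPointField`,
`WeilClassesTensorPointFieldLines` — `weilClassesField_le_algebraicClasses_of_companion` —,
`WeilClassesTensorPointIsogenyCone` — `…_of_companionCone`, `…_of_isogenyPair_companion` —,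
`Deligne1982/TensorPointOfPower`, `Deligne1982/TensorPointWeilTypeCM` — `eigenMultiplicity_eq_of_companion`). Those
files treat Deligne's `A₀ ⊗ E` as a COMPANION TENSOR STRUCTURE (product cones `IsLimit (Fan.mk A q)` / `T.powSucc`,
`φ` the companion matrix of `P`, and everything `E`-isogenous to it) and prove, by Deligne's explicit classes
`P_ρ = ∏ w_ρ(eᵢ)` (LNM 900 Lemma 4.5 / Rem. 4.10), that the `E`-Weil classes are ALGEBRAIC, and that the multiplicities
are `dim T`. The present file proves the
stronger DECOMPOSABILITY `W_F ⊗ ℂ ≤ 𝒟 ⊗ ℂ` (Moonen–Zarhin's notion; algebraicity is then re-derived by Lefschetz (1,1)),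
for the `F`-structures through an ARBITRARY integer matrix `α` with `P(α) = 0` (any `ℤ[α]`-lattice `Λ`, `A ⊗_ℤ Λ`), on
Mathlib's biproduct, by Moonen–Zarhin's `G_div` mechanism; its algebraicity corollaries and §6 are new in carrier,
generality and proof only, not in substance, relative to that cluster.

Scope (honest column). The `F`-structures treated are those through `M_{n+1}(ℚ) ⊆ End⁰(A^{n+1})` (scalar matrices on
the multiplicity space), for an ARBITRARY `A`: no simplicity, no Albert type, no condition «`W_F` consists of Hodge
classes» is needed for the inclusion `W_F ⊗ ℂ ≤ 𝒟 ⊗ ℂ` (which in turn shows that these Weil classes ARE Hodge, indeed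
algebraic). Structures mixing `End⁰(A)` and the matrices (Deligne's twisted `A₀ ⊗ E` with `E ↪ End⁰(A₀)`, the genuinely
exceptional cases of the print's Theorem) are not of this form. On the biproduct carrier the file covers the special
constructions of the tree's `WeilClassesSplitSquare` (`A × A`, `F = ℚ(i)`), `WeilClassesFieldSplitSquareZetaEight`
(`(T × T) × (T × T)`, `F = ℚ(ζ₈)`) and of the tensor-point cluster above (companion matrices), which are stated on
iterated binary products, product cones and `powSucc` powers respectively; no transport between these carriers is
proved here.

## References

* [MoonenZarhin1998WeilClasses] B. J. J. Moonen, Yu. G. Zarhin, Weil classes on abelian varieties, J. reine angew.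
  Math. 496 (1998) 83–92; arXiv:alg-geom/9612017, §1 (S_λ, B, G_div, the forms φ_s, Criterion (2), Theorem).
* [Deligne1982HodgeCycles] P. Deligne, Hodge cycles on abelian varieties, in LNM 900 (1982), §4 (4.4)–(4.5).
* [Milne1999LefschetzClasses] J. S. Milne, Lefschetz classes on abelian varieties, Duke Math. J. 96 (1999), §1 p. 643.
* [LangeBirkenhake1992] H. Lange, Ch. Birkenhake, Complex Abelian Varieties, §1.1, Lemma 1.1.17, §5.1, §5.3.
* [MumfordAV1970] D. Mumford, Abelian Varieties (1970), §19 (homomorphisms, matrices of endomorphisms of products).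
* [Shimura1998] G. Shimura, Abelian Varieties with Complex Multiplication and Modular Functions (1998), §6.2.
* [HatcherAT2002] A. Hatcher, Algebraic Topology (2002), §3.2 Prop. 3.10, Thm. 3.16.
* [VoisinHodgeI2002] C. Voisin, Hodge Theory and Complex Algebraic Geometry I (2002), Thm. 11.30 (Lefschetz (1,1)).
-/

noncomputable section

namespace Literature.AlgebraicGeometry.HodgeTheory

open Literature.AlgebraicGeometry.Motives
open Literature.AlgebraicGeometry.VanGeemen1994 (hodgeClassSpan pullbackOne)
open Literature.AlgebraicGeometry.Milne1999 (sumPolarizationClass sumPolarizationClass_def sumPolarizationClass_hypotheses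
  polarizationPairingOne_sum_map_π_map_π_of_ne exists_injective_linearMap_topDegree)
open Literature.AlgebraicGeometry.Pohlmann1968 (complexBetti_map_sum_one_apply map_ι_map_π_self map_ι_map_π_ne
  sum_map_π_map_ι)
open Literature.AlgebraicTopology.SingularHomology
open Literature.Barriers.HodgeConjecture (divisorClassesSpan)
open Literature.Geometry.Kaehler (lefschetzPow lefschetzPow_map)
open CategoryTheory CategoryTheory.Limits Polynomial Module

section TensorNumberField

variable {A : AbelianVariety ℂ} {h : complexBetti A.X 2} {n : ℕ}

/-! ### §1 Integer matrices acting on `A^{n+1}`: `φ ≫ πᵢ = Σⱼ αᵢⱼ πⱼ`, composition, polynomials -/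

/-- **Composition multiplies matrices**: if `φ ≫ πᵢ = Σⱼ αᵢⱼ πⱼ` and `ψ ≫ πᵢ = Σⱼ βᵢⱼ πⱼ` then
`(φ ≫ ψ) ≫ πᵢ = Σⱼ (β α)ᵢⱼ πⱼ` (on points `x ↦ α x ↦ β α x`). [cite: MumfordAV1970, §19 (Hom(X, Y) and matrices of
homomorphisms of products, pp. 172–176)] -/
theorem biproduct_comp_comp_π_of_matrix {φ ψ : ⨁ (fun _ : Fin (n + 1) => A) ⟶ ⨁ (fun _ : Fin (n + 1) => A)}
    {α β : Matrix (Fin (n + 1)) (Fin (n + 1)) ℤ}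
    (hφ : ∀ i, φ ≫ biproduct.π (fun _ : Fin (n + 1) => A) i = ∑ j, α i j • biproduct.π (fun _ : Fin (n + 1) => A) j)
    (hψ : ∀ i, ψ ≫ biproduct.π (fun _ : Fin (n + 1) => A) i = ∑ j, β i j • biproduct.π (fun _ : Fin (n + 1) => A) j)
    (i : Fin (n + 1)) :
    (φ ≫ ψ) ≫ biproduct.π (fun _ : Fin (n + 1) => A) i = ∑ j, (β * α) i j • biproduct.π (fun _ : Fin (n + 1) => A) j := by
  rw [Category.assoc, hψ, Preadditive.comp_sum]
  simp_rw [Matrix.mul_apply, Preadditive.comp_zsmul, hφ, Finset.smul_sum, smul_smul, Finset.sum_smul]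
  exact Finset.sum_comm

/-- **Polynomials in `φ` have the polynomial matrices**: `P(φ) ≫ πᵢ = Σⱼ P(α)ᵢⱼ πⱼ` for every `P ∈ ℤ[T]`
(`End(A^{n+1}) ⊇ M_{n+1}(ℤ)` is a ring homomorphism `α ↦ φ_α`). [cite: MumfordAV1970, §19 (pp. 172–176)]
[cite: Shimura1998, §6.2 (the representation of `End(A^h)` by matrices)] -/
theorem biproduct_eval₂_comp_π_of_matrix {φ : ⨁ (fun _ : Fin (n + 1) => A) ⟶ ⨁ (fun _ : Fin (n + 1) => A)}
    {α : Matrix (Fin (n + 1)) (Fin (n + 1)) ℤ}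
    (hφ : ∀ i, φ ≫ biproduct.π (fun _ : Fin (n + 1) => A) i = ∑ j, α i j • biproduct.π (fun _ : Fin (n + 1) => A) j)
    (P : Polynomial ℤ) (i : Fin (n + 1)) :
    End.asHom (Polynomial.eval₂ (Int.castRingHom (CategoryTheory.End (⨁ (fun _ : Fin (n + 1) => A)))) (End.of φ) P) ≫
      biproduct.π (fun _ : Fin (n + 1) => A) i =
      ∑ j, (Polynomial.eval₂ (Int.castRingHom (Matrix (Fin (n + 1)) (Fin (n + 1)) ℤ)) α P) i j • biproduct.π
          (fun _ : Fin (n + 1) => A) j := by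
  induction P using Polynomial.induction_on generalizing i with
  | C a =>
    rw [eval₂_C, eval₂_C, eq_intCast, eq_intCast,
      Finset.sum_eq_single i (fun j _ hji => by rw [Matrix.intCast_apply, if_neg (Ne.symm hji), Int.cast_zero, zero_smul])
        (fun hi => absurd (Finset.mem_univ i) hi), Matrix.intCast_apply, if_pos rfl, Int.cast_id]
    change ((a : CategoryTheory.End (⨁ (fun _ : Fin (n + 1) => A))) : ⨁ (fun _ : Fin (n + 1) => A) ⟶ ⨁
          (fun _ : Fin (n + 1) => A)) ≫ biproduct.π (fun _ : Fin (n + 1) => A) i = a • biproduct.π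
          (fun _ : Fin (n + 1) => A) i
    rw [← zsmul_one a]
    change (a • 𝟙 (⨁ (fun _ : Fin (n + 1) => A))) ≫ biproduct.π (fun _ : Fin (n + 1) => A) i = _
    rw [Preadditive.zsmul_comp, Category.id_comp]
  | add p q hp hq =>
    rw [eval₂_add, eval₂_add]
    change (End.asHom (eval₂ _ (End.of φ) p) + End.asHom (eval₂ _ (End.of φ) q)) ≫ biproduct.π
        (fun _ : Fin (n + 1) => A) i = _
    rw [Preadditive.add_comp, hp, hq, ← Finset.sum_add_distrib]
    simp_rw [Matrix.add_apply, add_smul]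
  | monomial k a hk =>
    rw [pow_succ, ← mul_assoc, eval₂_mul_X, eval₂_mul_X]
    change (φ ≫ End.asHom (eval₂ _ (End.of φ) (Polynomial.C a * X ^ k))) ≫ biproduct.π (fun _ : Fin (n + 1) => A) i = _
    exact biproduct_comp_comp_π_of_matrix hφ hk i

/-- **`P(α) = 0 ⟹ P(φ) = 0`** in `End(A^{n+1})` for the endomorphism `φ` of matrix `α` (a morphism into a biproduct is
determined by its components). [cite: MumfordAV1970, §19 (pp. 172–176)] [cite: Shimura1998, §6.2] -/
theorem biproduct_eval₂_eq_zero_of_matrix {φ : ⨁ (fun _ : Fin (n + 1) => A) ⟶ ⨁ (fun _ : Fin (n + 1) => A)}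
    {α : Matrix (Fin (n + 1)) (Fin (n + 1)) ℤ}
    (hφ : ∀ i, φ ≫ biproduct.π (fun _ : Fin (n + 1) => A) i = ∑ j, α i j • biproduct.π (fun _ : Fin (n + 1) => A) j)
    {P : Polynomial ℤ}
    (hα : Polynomial.eval₂ (Int.castRingHom (Matrix (Fin (n + 1)) (Fin (n + 1)) ℤ)) α P = 0) :
    Polynomial.eval₂ (Int.castRingHom (CategoryTheory.End (⨁ (fun _ : Fin (n + 1) => A)))) (End.of φ) P = 0 := by
  have key : End.asHom
      (Polynomial.eval₂ (Int.castRingHom (CategoryTheory.End (⨁ (fun _ : Fin (n + 1) => A)))) (End.of φ) P) =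
      (0 : ⨁ (fun _ : Fin (n + 1) => A) ⟶ ⨁ (fun _ : Fin (n + 1) => A)) :=
    biproduct.hom_ext _ _ fun i => by
      rw [Limits.zero_comp, biproduct_eval₂_comp_π_of_matrix hφ P i, hα]
      exact Finset.sum_eq_zero fun j _ => by rw [Matrix.zero_apply, zero_smul]
  exact key

/-- The endomorphism `biproduct.lift (i ↦ Σⱼ αᵢⱼ πⱼ)` HAS the matrix `α`. [cite: MumfordAV1970, §19 (pp. 172–176)] -/
theorem biproduct_lift_sum_zsmul_π_comp_π (α : Matrix (Fin (n + 1)) (Fin (n + 1)) ℤ) (i : Fin (n + 1)) :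
    biproduct.lift (fun i => ∑ j, α i j • biproduct.π (fun _ : Fin (n + 1) => A) j) ≫ biproduct.π (fun _ : Fin (n + 1) => A)
      i = ∑ j, α i j • biproduct.π (fun _ : Fin (n + 1) => A) j :=
  biproduct.lift_π _ _

/-- A morphism into `A^{n+1}` is the sum of its components followed by the inclusions: `φ = Σᵢ (φ ≫ πᵢ) ≫ ιᵢ`, so an
endomorphism of matrix `α` is `Σᵢⱼ αᵢⱼ (πⱼ ≫ ιᵢ)`. [cite: MumfordAV1970, §19 (pp. 172–176)] -/
theorem biproduct_eq_sum_zsmul_π_comp_ι_of_matrix {φ : ⨁ (fun _ : Fin (n + 1) => A) ⟶ ⨁ (fun _ : Fin (n + 1) => A)}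
    {α : Matrix (Fin (n + 1)) (Fin (n + 1)) ℤ}
    (hφ : ∀ i, φ ≫ biproduct.π (fun _ : Fin (n + 1) => A) i = ∑ j, α i j • biproduct.π (fun _ : Fin (n + 1) => A) j) :
    φ = ∑ i, ∑ j, α i j • (biproduct.π (fun _ : Fin (n + 1) => A) j ≫ biproduct.ι (fun _ : Fin (n + 1) => A) i) := by
  calc φ = φ ≫ ∑ i, biproduct.π (fun _ : Fin (n + 1) => A) i ≫ biproduct.ι (fun _ : Fin (n + 1) => A) i := by rw
      [biproduct.total, Category.comp_id]
    _ = ∑ i, (φ ≫ biproduct.π (fun _ : Fin (n + 1) => A) i) ≫ biproduct.ι (fun _ : Fin (n + 1) => A) i := by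
      rw [Preadditive.comp_sum]
      simp_rw [Category.assoc]
    _ = _ := by simp_rw [hφ, Preadditive.sum_comp, Preadditive.zsmul_comp]

/-! ### §2 Pull-backs on `H¹(A^{n+1}) = ⊕ᵢ πᵢ^* H¹(A)` -/

/-- `(f ≫ g)^* = f^* ∘ g^*` on `H¹`, in `Module.End`. [folklore] -/
private theorem pullbackOne_comp_eq_mul {X : AbelianVariety ℂ} (f g : X ⟶ X) :
    pullbackOne X (f ≫ g) = pullbackOne X f * pullbackOne X g := by
  change (complexBetti.map (f.hom.hom.hom ≫ g.hom.hom.hom) 1).hom = _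
  rw [complexBetti.map_comp, ModuleCat.hom_comp]
  rfl

/-- `(k • f)^* c = k • f^* c` on `H¹`, applied form of the tree's `complexBetti_map_zsmul_one`. [folklore] -/
private theorem complexBetti_map_zsmul_one_apply' {X Y : AbelianVariety ℂ} (k : ℤ) (f : X ⟶ Y)
    (c : complexBetti Y.X 1) :
    complexBetti.map (k • f).hom.hom.hom 1 c = ((k : ℤ) : ℂ) • complexBetti.map f.hom.hom.hom 1 c := by
  change (complexBetti.map (k • f).hom.hom.hom 1).hom c = _
  rw [complexBetti_map_zsmul_one, ModuleCat.hom_zsmul, LinearMap.smul_apply, ← Int.cast_smul_eq_zsmul ℂ]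

/-- `(πₐ ≫ ι_b)^* x = πₐ^* (ι_b^* x)`. [folklore] -/
private theorem pullbackOne_π_comp_ι_apply (a b : Fin (n + 1)) (x : complexBetti (⨁ (fun _ : Fin (n + 1) => A)).X 1) :
    pullbackOne (⨁ (fun _ : Fin (n + 1) => A))
      (biproduct.π (fun _ : Fin (n + 1) => A) a ≫ biproduct.ι (fun _ : Fin (n + 1) => A) b) x =
      complexBetti.map (biproduct.π (fun _ : Fin (n + 1) => A) a).hom.hom.hom 1
          (complexBetti.map (biproduct.ι (fun _ : Fin (n + 1) => A) b).hom.hom.hom 1 x) := by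
  change singularCohomology.map ℂ ℂ _ 1 x = singularCohomology.map ℂ ℂ _ 1 (singularCohomology.map ℂ ℂ _ 1 x)
  rw [abelianVarietyHom_map_map_apply]

/-- **An endomorphism of matrix `α` acts on `πᵢ^* H¹(A)` through the `i`-th ROW of `α`**:
`φ^* (πᵢ^* a) = Σⱼ αᵢⱼ πⱼ^* a` (`(φ ≫ πᵢ)^* = φ^* ∘ πᵢ^*`, additivity of pull-backs on `H¹`).
[cite: LangeBirkenhake1992, §1.1 (p. 19: the rational representation)] [cite: MumfordAV1970, §19 (pp. 172–176)] -/
theorem pullbackOne_map_π_of_matrix {φ : ⨁ (fun _ : Fin (n + 1) => A) ⟶ ⨁ (fun _ : Fin (n + 1) => A)}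
    {α : Matrix (Fin (n + 1)) (Fin (n + 1)) ℤ}
    (hφ : ∀ i, φ ≫ biproduct.π (fun _ : Fin (n + 1) => A) i = ∑ j, α i j • biproduct.π (fun _ : Fin (n + 1) => A) j)
    (i : Fin (n + 1)) (a : complexBetti A.X 1) :
    pullbackOne (⨁ (fun _ : Fin (n + 1) => A)) φ
      (complexBetti.map (biproduct.π (fun _ : Fin (n + 1) => A) i).hom.hom.hom 1 a) =
      ∑ j, ((α i j : ℤ) : ℂ) • complexBetti.map (biproduct.π (fun _ : Fin (n + 1) => A) j).hom.hom.hom 1 a := by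
  change singularCohomology.map ℂ ℂ _ 1 (singularCohomology.map ℂ ℂ _ 1 a) = _
  rw [abelianVarietyHom_map_map_apply, hφ]
  change complexBetti.map (∑ j, α i j • biproduct.π (fun _ : Fin (n + 1) => A) j).hom.hom.hom 1 a = _
  rw [complexBetti_map_sum_one_apply]
  exact Finset.sum_congr rfl fun j _ => complexBetti_map_zsmul_one_apply' _ _ _

/-- **`φ^* = Σᵢⱼ αᵢⱼ (πⱼ ≫ ιᵢ)^*` on `H¹(A^{n+1})`.** [cite: LangeBirkenhake1992, §1.1 (p. 19)]
[cite: MumfordAV1970, §19 (pp. 172–176)] -/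
theorem pullbackOne_eq_sum_of_matrix {φ : ⨁ (fun _ : Fin (n + 1) => A) ⟶ ⨁ (fun _ : Fin (n + 1) => A)}
    {α : Matrix (Fin (n + 1)) (Fin (n + 1)) ℤ}
    (hφ : ∀ i, φ ≫ biproduct.π (fun _ : Fin (n + 1) => A) i = ∑ j, α i j • biproduct.π (fun _ : Fin (n + 1) => A) j) :
    pullbackOne (⨁ (fun _ : Fin (n + 1) => A)) φ = ∑ i, ∑ j, ((α i j : ℤ) : ℂ) • pullbackOne (⨁ (fun _ : Fin (n + 1) => A))
      (biproduct.π (fun _ : Fin (n + 1) => A) j ≫ biproduct.ι (fun _ : Fin (n + 1) => A) i) := by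
  ext x
  rw [LinearMap.sum_apply]
  simp_rw [LinearMap.sum_apply, LinearMap.smul_apply]
  change complexBetti.map φ.hom.hom.hom 1 x = _
  conv_lhs => rw [biproduct_eq_sum_zsmul_π_comp_ι_of_matrix hφ]
  rw [complexBetti_map_sum_one_apply]
  refine Finset.sum_congr rfl fun i _ => ?_
  rw [complexBetti_map_sum_one_apply]
  exact Finset.sum_congr rfl fun j _ => complexBetti_map_zsmul_one_apply' _ _ _

/-- **The components of a `ρ`-eigenvector of `φ^*` form a `ρ`-eigenvector of `αᵀ` with coefficients in `H¹(A)`**: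
if `φ^* v = ρ v` and `vₖ := ιₖ^* v` then `Σᵢ αᵢⱼ vᵢ = ρ vⱼ` for every `j`.
[cite: MoonenZarhin1998WeilClasses, §1 (V_ℂ = ⊕_σ V_{ℂ,σ}; chunk p0001 L70–L86)] [cite: MumfordAV1970, §19 (pp. 172–176)] -/
theorem sum_smul_map_ι_eq_of_mem_eigenspace_of_matrix {φ : ⨁ (fun _ : Fin (n + 1) => A) ⟶ ⨁ (fun _ : Fin (n + 1) => A)}
    {α : Matrix (Fin (n + 1)) (Fin (n + 1)) ℤ}
    (hφ : ∀ i, φ ≫ biproduct.π (fun _ : Fin (n + 1) => A) i = ∑ j, α i j • biproduct.π (fun _ : Fin (n + 1) => A) j) {ρ : ℂ}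
    {v : complexBetti (⨁ (fun _ : Fin (n + 1) => A)).X 1}
    (hv : v ∈ Module.End.eigenspace (pullbackOne (⨁ (fun _ : Fin (n + 1) => A)) φ) ρ) (j : Fin (n + 1)) :
    ∑ i, ((α i j : ℤ) : ℂ) • complexBetti.map (biproduct.ι (fun _ : Fin (n + 1) => A) i).hom.hom.hom 1 v =
      ρ • complexBetti.map (biproduct.ι (fun _ : Fin (n + 1) => A) j).hom.hom.hom 1 v := by
  rw [Module.End.mem_eigenspace_iff] at hv
  have h1 : complexBetti.map (biproduct.ι (fun _ : Fin (n + 1) => A) j).hom.hom.hom 1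
      (pullbackOne (⨁ (fun _ : Fin (n + 1) => A)) φ v) =
      ρ • complexBetti.map (biproduct.ι (fun _ : Fin (n + 1) => A) j).hom.hom.hom 1 v := by rw [hv, map_smul]
  rw [← h1]
  conv_rhs => rw [← sum_map_π_map_ι (fun _ : Fin (n + 1) => A) v, map_sum]
  simp_rw [pullbackOne_map_π_of_matrix hφ]
  rw [map_sum]
  simp_rw [map_sum, map_smul]
  refine Finset.sum_congr rfl fun k _ => ?_
  rw [Finset.sum_eq_single j (fun j' _ hj' => by rw [map_ι_map_π_ne (fun _ : Fin (n + 1) => A) (Ne.symm hj'), smul_zero])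
    (fun hj => absurd (Finset.mem_univ j) hj), map_ι_map_π_self]

/-- **The graph map `u_ℓ : a ↦ Σᵢ ℓᵢ πᵢ^* a` of a row eigenvector `ℓ α = ρ ℓ` lands in the eigenspace `V_ρ` of `φ^*`.**
[cite: MoonenZarhin1998WeilClasses, §1 (chunk p0001 L70–L86)] [cite: Deligne1982HodgeCycles, §4 (4.4)–(4.5)] -/
theorem sum_smul_map_π_mem_eigenspace_of_matrix {φ : ⨁ (fun _ : Fin (n + 1) => A) ⟶ ⨁ (fun _ : Fin (n + 1) => A)}
    {α : Matrix (Fin (n + 1)) (Fin (n + 1)) ℤ}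
    (hφ : ∀ i, φ ≫ biproduct.π (fun _ : Fin (n + 1) => A) i = ∑ j, α i j • biproduct.π (fun _ : Fin (n + 1) => A) j) {ρ : ℂ}
    {ℓ : Fin (n + 1) → ℂ}
    (hℓ : ∀ j, ∑ i, ((α i j : ℤ) : ℂ) * ℓ i = ρ * ℓ j) (a : complexBetti A.X 1) :
    ∑ i, ℓ i • complexBetti.map (biproduct.π (fun _ : Fin (n + 1) => A) i).hom.hom.hom 1 a ∈ Module.End.eigenspace
      (pullbackOne (⨁ (fun _ : Fin (n + 1) => A)) φ) ρ := by
  rw [Module.End.mem_eigenspace_iff, map_sum, Finset.smul_sum]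
  simp_rw [map_smul, pullbackOne_map_π_of_matrix hφ, Finset.smul_sum, smul_smul]
  rw [Finset.sum_comm]
  refine Finset.sum_congr rfl fun j _ => ?_
  rw [← Finset.sum_smul, ← hℓ j]
  simp_rw [mul_comm (ℓ _)]

/-- **A row eigenvector of `α` at `ρ` from a non-zero `ρ`-eigenvector of `φ^*`**: if `V_ρ ≠ 0` there is
`ℓ : Fin (n+1) → ℂ`, not identically zero, with `Σᵢ αᵢⱼ ℓᵢ = ρ ℓⱼ` (apply a linear functional to the components
of an eigenvector). [cite: MoonenZarhin1998WeilClasses, §1 (chunk p0001 L70–L86)]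
[cite: MumfordAV1970, §19 (pp. 172–176)] -/
theorem exists_rowEigenvector_of_eigenspace_ne_bot_of_matrix
    {φ : ⨁ (fun _ : Fin (n + 1) => A) ⟶ ⨁ (fun _ : Fin (n + 1) => A)}
    {α : Matrix (Fin (n + 1)) (Fin (n + 1)) ℤ}
    (hφ : ∀ i, φ ≫ biproduct.π (fun _ : Fin (n + 1) => A) i = ∑ j, α i j • biproduct.π (fun _ : Fin (n + 1) => A) j)
    {ρ : ℂ} (hV : Module.End.eigenspace (pullbackOne (⨁ (fun _ : Fin (n + 1) => A)) φ) ρ ≠ ⊥) :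
    ∃ ℓ : Fin (n + 1) → ℂ, (∃ i₀, ℓ i₀ ≠ 0) ∧ ∀ j, ∑ i, ((α i j : ℤ) : ℂ) * ℓ i = ρ * ℓ j := by
  obtain ⟨v, hv, hv0⟩ := (Submodule.ne_bot_iff _).1 hV
  have hex : ∃ i₀, complexBetti.map (biproduct.ι (fun _ : Fin (n + 1) => A) i₀).hom.hom.hom 1 v ≠ 0 := by
    by_contra hall
    apply hv0
    rw [← sum_map_π_map_ι (fun _ : Fin (n + 1) => A) v]
    exact Finset.sum_eq_zero fun i _ => by rw [not_not.1 (not_exists.1 hall i), map_zero]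
  obtain ⟨i₀, hi₀⟩ := hex
  obtain ⟨lam, hlam⟩ := Module.Projective.exists_dual_ne_zero ℂ hi₀
  refine ⟨fun i => lam (complexBetti.map (biproduct.ι (fun _ : Fin (n + 1) => A) i).hom.hom.hom 1 v),
        ⟨i₀, hlam⟩, fun j => ?_⟩
  have e := congrArg lam (sum_smul_map_ι_eq_of_mem_eigenspace_of_matrix hφ hv j)
  rw [map_sum, map_smul, smul_eq_mul] at e
  simp_rw [map_smul, smul_eq_mul] at e
  exact e

/-- **`V_ρ = u_ℓ(H¹(A))` — the eigenspace of `φ^*` at a root `ρ` of `P` is the graph of a row eigenvector**: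
for `ℓ α = ρ ℓ` with `ℓ_{i₀} ≠ 0`, every `v ∈ V_ρ` is `Σᵢ ℓᵢ πᵢ^* a` for a unique `a ∈ H¹(A)` (`u_ℓ` is injective
with image in `V_ρ`, and `dim V_ρ = 2 dim A = dim H¹(A)` when `P` is irreducible of degree `n + 1` with
`P(φ) = 0`). [cite: MoonenZarhin1998WeilClasses, §1 (dim V_σ = 2g/[F:ℚ]; chunk p0001 L70–L86)]
[cite: Deligne1982HodgeCycles, §4 (4.4)–(4.5)] -/
theorem exists_eq_sum_smul_map_π_of_mem_eigenspace_of_matrix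
    {φ : ⨁ (fun _ : Fin (n + 1) => A) ⟶ ⨁ (fun _ : Fin (n + 1) => A)}
    {α : Matrix (Fin (n + 1)) (Fin (n + 1)) ℤ}
    (hφ : ∀ i, φ ≫ biproduct.π (fun _ : Fin (n + 1) => A) i = ∑ j, α i j • biproduct.π (fun _ : Fin (n + 1) => A) j)
    {P : Polynomial ℤ} (hPm : P.Monic) (hPe : P.natDegree = n + 1) (hPirr : Irreducible (P.map (Int.castRingHom ℚ)))
    (hφP : Polynomial.eval₂ (Int.castRingHom (CategoryTheory.End (⨁ (fun _ : Fin (n + 1) => A)))) (End.of φ) P = 0)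
    (her : (n + 1) * (2 * A.dim) = 2 * (⨁ (fun _ : Fin (n + 1) => A)).dim) {ρ : ℂ}
    (hρ : Polynomial.eval₂ (Int.castRingHom ℂ) ρ P = 0)
    {ℓ : Fin (n + 1) → ℂ} (hℓ : ∀ j, ∑ i, ((α i j : ℤ) : ℂ) * ℓ i = ρ * ℓ j) {i₀ : Fin (n + 1)} (hi₀ : ℓ i₀ ≠ 0)
    {v : complexBetti (⨁ (fun _ : Fin (n + 1) => A)).X 1}
    (hv : v ∈ Module.End.eigenspace (pullbackOne (⨁ (fun _ : Fin (n + 1) => A)) φ) ρ) :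
    ∃ a : complexBetti A.X 1, v = ∑ i, ℓ i • complexBetti.map
      (biproduct.π (fun _ : Fin (n + 1) => A) i).hom.hom.hom 1 a := by
  haveI : Module.Finite ℂ (complexBetti (⨁ (fun _ : Fin (n + 1) => A)).X 1) :=
      abelianVarietyCohomologyExteriorH1_holds.finite_one _
  let u : complexBetti A.X 1 →ₗ[ℂ] complexBetti (⨁ (fun _ : Fin (n + 1) => A)).X 1 :=
    ∑ i, ℓ i • (complexBetti.map (biproduct.π (fun _ : Fin (n + 1) => A) i).hom.hom.hom 1).hom
  have hu : ∀ a, u a = ∑ i, ℓ i • complexBetti.map (biproduct.π (fun _ : Fin (n + 1) => A) i).hom.hom.hom 1 a := fun a => by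
    simp only [u, LinearMap.sum_apply, LinearMap.smul_apply]
  have hinj : Function.Injective u := by
    rw [← LinearMap.ker_eq_bot, LinearMap.ker_eq_bot']
    intro a ha
    have e := congrArg (complexBetti.map (biproduct.ι (fun _ : Fin (n + 1) => A) i₀).hom.hom.hom 1) ha
    rw [hu, map_sum, map_zero, Finset.sum_eq_single i₀ (fun k _ hk => by
      rw [map_smul, map_ι_map_π_ne (fun _ : Fin (n + 1) => A) (Ne.symm hk), smul_zero])
            (fun h0 => absurd (Finset.mem_univ i₀) h0),
      map_smul, map_ι_map_π_self] at e
    exact (smul_eq_zero.1 e).resolve_left hi₀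
  have hle : LinearMap.range u ≤ Module.End.eigenspace (pullbackOne (⨁ (fun _ : Fin (n + 1) => A)) φ) ρ := by
    rintro _ ⟨a, rfl⟩
    rw [hu]
    exact sum_smul_map_π_mem_eigenspace_of_matrix hφ hℓ a
  have hr : Module.finrank ℂ (LinearMap.range u) =
      Module.finrank ℂ (Module.End.eigenspace (pullbackOne (⨁ (fun _ : Fin (n + 1) => A)) φ) ρ) := by
    rw [LinearMap.finrank_range_of_inj hinj, AbelianVariety.finrank_complexBetti_one,
      finrank_eigenspace_eq_of_root hPm hPe hPirr hφP her hρ]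
  have heq := Submodule.eq_of_le_of_finrank_eq hle hr
  rw [← heq] at hv
  obtain ⟨a, rfl⟩ := hv
  exact ⟨a, hu a⟩

/-! ### §3 The product polarization `D = Σᵢ πᵢ^* h` on `A^{n+1}`: block form, permutation invariance -/

/-- `dim A^{n+1} = (n + 1) dim A`. [cite: MumfordAV1970, §19 (pp. 172–176)] -/
theorem dim_biproduct_const_succ (A : AbelianVariety ℂ) : ∀ n : ℕ, (⨁ fun _ : Fin (n + 1) => A).dim = (n + 1) * A.dim
  | 0 => by
    rw [AbelianVariety.dim_eq_of_isIsogeny (Milne1999.isIsogeny_biproduct_π_fin_one fun _ : Fin (0 + 1) => A),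
      zero_add, one_mul]
  | n + 1 => by
    rw [Milne1999.dim_biproduct_succ, dim_biproduct_const_succ A n]
    ring

/-- **The pairing `Q_D` against a class pulled back from ONE factor only sees that factor**:
`Q_D(πₐ^* c, y) = Q_D(πₐ^* c, πₐ^* ιₐ^* y)` (the mixed blocks vanish, `y = Σₖ πₖ^* ιₖ^* y`).
[cite: Milne1999LefschetzClasses, §1 p. 643] [cite: LangeBirkenhake1992, §5.3] -/
theorem polarizationPairingOne_sum_map_π_left (hA : 0 < A.dim) (a : Fin (n + 1)) (c : complexBetti A.X 1)
    (y : complexBetti (⨁ (fun _ : Fin (n + 1) => A)).X 1) :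
    polarizationPairingOne (⨁ (fun _ : Fin (n + 1) => A)).X (sumPolarizationClass (fun _ : Fin (n + 1) => A) fun _ => h)
      ((⨁ (fun _ : Fin (n + 1) => A)).dim - 1)
        (complexBetti.map (biproduct.π (fun _ : Fin (n + 1) => A) a).hom.hom.hom 1 c) y =
      polarizationPairingOne (⨁ (fun _ : Fin (n + 1) => A)).X (sumPolarizationClass (fun _ : Fin (n + 1) => A) fun _ => h)
          ((⨁ (fun _ : Fin (n + 1) => A)).dim - 1)
        (complexBetti.map (biproduct.π (fun _ : Fin (n + 1) => A) a).hom.hom.hom 1 c)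
        (complexBetti.map (biproduct.π (fun _ : Fin (n + 1) => A) a).hom.hom.hom 1
              (complexBetti.map (biproduct.ι (fun _ : Fin (n + 1) => A) a).hom.hom.hom 1 y)) := by
  conv_lhs => rw [← sum_map_π_map_ι (fun _ : Fin (n + 1) => A) y, map_sum]
  exact Finset.sum_eq_single a
    (fun k _ hka => polarizationPairingOne_sum_map_π_map_π_of_ne (fun _ : Fin (n + 1) => A) (fun _ => h) (fun _ => hA)
        (Ne.symm hka) _ _)
    (fun ha => absurd (Finset.mem_univ a) ha)

/-- … and symmetrically `Q_D(x, πₐ^* c) = Q_D(πₐ^* ιₐ^* x, πₐ^* c)`. [cite: Milne1999LefschetzClasses, §1 p. 643]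
[cite: LangeBirkenhake1992, §5.3] -/
theorem polarizationPairingOne_sum_map_π_right (hA : 0 < A.dim) (a : Fin (n + 1))
    (x : complexBetti (⨁ (fun _ : Fin (n + 1) => A)).X 1)
    (c : complexBetti A.X 1) :
    polarizationPairingOne (⨁ (fun _ : Fin (n + 1) => A)).X (sumPolarizationClass (fun _ : Fin (n + 1) => A) fun _ => h)
      ((⨁ (fun _ : Fin (n + 1) => A)).dim - 1) x
        (complexBetti.map (biproduct.π (fun _ : Fin (n + 1) => A) a).hom.hom.hom 1 c) =
      polarizationPairingOne (⨁ (fun _ : Fin (n + 1) => A)).X (sumPolarizationClass (fun _ : Fin (n + 1) => A) fun _ => h)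
          ((⨁ (fun _ : Fin (n + 1) => A)).dim - 1)
        (complexBetti.map (biproduct.π (fun _ : Fin (n + 1) => A) a).hom.hom.hom 1
              (complexBetti.map (biproduct.ι (fun _ : Fin (n + 1) => A) a).hom.hom.hom 1 x))
        (complexBetti.map (biproduct.π (fun _ : Fin (n + 1) => A) a).hom.hom.hom 1 c) := by
  conv_lhs => rw [← sum_map_π_map_ι (fun _ : Fin (n + 1) => A) x, map_sum, LinearMap.sum_apply]
  exact Finset.sum_eq_single a
    (fun k _ hka => polarizationPairingOne_sum_map_π_map_π_of_ne (fun _ : Fin (n + 1) => A) (fun _ => h)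
        (fun _ => hA) hka _ _)
    (fun ha => absurd (Finset.mem_univ a) ha)

/-- **The diagonal blocks of `Q_D` on `A^{n+1}` are all THE SAME form**: `Q_D(πᵢ^* a, πᵢ^* b) = Q_D(πⱼ^* a, πⱼ^* b)`.
The transposition `σ` of the factors `i, j` is an automorphism with `σ^* D = D`, so `Q_D(σ^* x, σ^* y) = σ^* Q_D(x, y)`
(naturality of cup products), and `σ^*` is the identity on the top-degree line `H^{2 dim}(A^{n+1}) ∋ D^{dim} ≠ 0`,
which it fixes. («the involution `D` defines on `C(A)` is the restriction of the product of the involutions».)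
[cite: Milne1999LefschetzClasses, §1 p. 643] [cite: LangeBirkenhake1992, §5.3 and Lemma 1.1.17]
[cite: HatcherAT2002, §3.2 Prop. 3.10] -/
theorem polarizationPairingOne_sum_map_π_map_π_eq_of_const (hA : 0 < A.dim) (hh : h ∈ hodgeClassSpan A.dim A.X 1)
    (htop : lefschetzPow h (A.dim - 1) 2 h ≠ 0)
    (hnd : ∀ x : complexBetti A.X 1, (∀ y, polarizationPairingOne A.X h (A.dim - 1) x y = 0) → x = 0)
    (i j : Fin (n + 1)) (a b : complexBetti A.X 1) :
    polarizationPairingOne (⨁ (fun _ : Fin (n + 1) => A)).X (sumPolarizationClass (fun _ : Fin (n + 1) => A) fun _ => h)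
      ((⨁ (fun _ : Fin (n + 1) => A)).dim - 1)
        (complexBetti.map (biproduct.π (fun _ : Fin (n + 1) => A) i).hom.hom.hom 1 a)
            (complexBetti.map (biproduct.π (fun _ : Fin (n + 1) => A) i).hom.hom.hom 1 b) =
      polarizationPairingOne (⨁ (fun _ : Fin (n + 1) => A)).X (sumPolarizationClass (fun _ : Fin (n + 1) => A) fun _ => h)
          ((⨁ (fun _ : Fin (n + 1) => A)).dim - 1)
        (complexBetti.map (biproduct.π (fun _ : Fin (n + 1) => A) j).hom.hom.hom 1 a)
            (complexBetti.map (biproduct.π (fun _ : Fin (n + 1) => A) j).hom.hom.hom 1 b) := by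
  obtain ⟨-, htopX, -⟩ := sumPolarizationClass_hypotheses (fun _ : Fin (n + 1) => A) (fun _ => h)
      (fun _ => hA) (fun _ => hh)
    (fun _ => htop) (fun _ => hnd)
  -- the transposition of the factors `i` and `j`
  let σ : ⨁ (fun _ : Fin (n + 1) => A) ⟶ ⨁ (fun _ : Fin (n + 1) => A) := biproduct.lift fun k => biproduct.π
      (fun _ : Fin (n + 1) => A) (Equiv.swap i j k)
  have hσπ : ∀ k, σ ≫ biproduct.π (fun _ : Fin (n + 1) => A) k = biproduct.π (fun _ : Fin (n + 1) => A) (Equiv.swap i j k)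
      := fun k => biproduct.lift_π _ _
  have hσ : ∀ (m : ℕ) (k : Fin (n + 1)) (c : complexBetti A.X m),
      complexBetti.map σ.hom.hom.hom m (complexBetti.map (biproduct.π (fun _ : Fin (n + 1) => A) k).hom.hom.hom m c) =
        complexBetti.map (biproduct.π (fun _ : Fin (n + 1) => A) (Equiv.swap i j k)).hom.hom.hom m c := fun m k c => by
    change singularCohomology.map ℂ ℂ _ m (singularCohomology.map ℂ ℂ _ m c) = _
    rw [abelianVarietyHom_map_map_apply, hσπ]
  have hσD : complexBetti.map σ.hom.hom.hom 2 (sumPolarizationClass (fun _ : Fin (n + 1) => A) fun _ => h) =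
      sumPolarizationClass (fun _ : Fin (n + 1) => A) fun _ => h := by
    rw [sumPolarizationClass_def, map_sum]
    simp_rw [hσ]
    exact Equiv.sum_comp (Equiv.swap i j) fun k => complexBetti.map
        (biproduct.π (fun _ : Fin (n + 1) => A) k).hom.hom.hom 2 h
  -- `σ^*` is the identity on the top-degree line, which contains `D^{dim} ≠ 0` fixed by `σ^*`
  have hL : complexBetti.map σ.hom.hom.hom (2 + 2 * ((⨁ (fun _ : Fin (n + 1) => A)).dim - 1))
      (lefschetzPow (sumPolarizationClass (fun _ : Fin (n + 1) => A) fun _ => h) ((⨁ (fun _ : Fin (n + 1) => A)).dim - 1) 2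
            (sumPolarizationClass (fun _ : Fin (n + 1) => A) fun _ => h)) =
      lefschetzPow (sumPolarizationClass (fun _ : Fin (n + 1) => A) fun _ => h) ((⨁ (fun _ : Fin (n + 1) => A)).dim - 1) 2
          (sumPolarizationClass (fun _ : Fin (n + 1) => A) fun _ => h) := by
    have e := lefschetzPow_map (AlgPoints.mapContinuous (L := ℂ) σ.hom.hom.hom)
        (sumPolarizationClass (fun _ : Fin (n + 1) => A) fun _ => h)
      ((⨁ (fun _ : Fin (n + 1) => A)).dim - 1) 2 (sumPolarizationClass (fun _ : Fin (n + 1) => A) fun _ => h)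
    have hσD' : singularCohomology.map ℂ ℂ (AlgPoints.mapContinuous (L := ℂ) σ.hom.hom.hom) 2
        (sumPolarizationClass (fun _ : Fin (n + 1) => A) fun _ => h) = sumPolarizationClass (fun _ : Fin (n + 1) => A)
            fun _ => h := hσD
    rw [hσD'] at e
    exact e
  obtain ⟨lam, hlam⟩ := exists_injective_linearMap_topDegree (⨁ (fun _ : Fin (n + 1) => A))
  have hT : ∀ z : complexBetti (⨁ (fun _ : Fin (n + 1) => A)).X (2 + 2 * ((⨁ (fun _ : Fin (n + 1) => A)).dim - 1)),
      complexBetti.map σ.hom.hom.hom _ z = z := by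
    intro z
    set L := lefschetzPow (sumPolarizationClass (fun _ : Fin (n + 1) => A) fun _ => h)
        ((⨁ (fun _ : Fin (n + 1) => A)).dim - 1) 2 (sumPolarizationClass (fun _ : Fin (n + 1) => A) fun _ => h)
    have hL0 : lam L ≠ 0 := fun h0 => htopX (hlam (by rw [h0, map_zero]))
    have key : lam L • z = lam z • L := hlam (by rw [map_smul, map_smul, smul_eq_mul, smul_eq_mul, mul_comm])
    have e : lam L • complexBetti.map σ.hom.hom.hom _ z = lam L • z := by
      rw [← map_smul, key, map_smul, hL]
    exact smul_right_injective _ hL0 e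
  -- conclusion: `πᵢ^* = σ^* πⱼ^*` and `Q_D(σ^* x, σ^* y) = σ^* Q_D(x, y) = Q_D(x, y)`
  have hi : ∀ c : complexBetti A.X 1, complexBetti.map (biproduct.π (fun _ : Fin (n + 1) => A) i).hom.hom.hom 1 c =
      complexBetti.map σ.hom.hom.hom 1 (complexBetti.map (biproduct.π (fun _ : Fin (n + 1) => A) j).hom.hom.hom 1 c)
          := fun c => by
    rw [hσ, Equiv.swap_apply_right]
  have key : ∀ x y : complexBetti (⨁ (fun _ : Fin (n + 1) => A)).X 1,
      polarizationPairingOne (⨁ (fun _ : Fin (n + 1) => A)).X (sumPolarizationClass (fun _ : Fin (n + 1) => A) fun _ => h)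
          ((⨁ (fun _ : Fin (n + 1) => A)).dim - 1)
        (complexBetti.map σ.hom.hom.hom 1 x) (complexBetti.map σ.hom.hom.hom 1 y) =
      polarizationPairingOne (⨁ (fun _ : Fin (n + 1) => A)).X (sumPolarizationClass (fun _ : Fin (n + 1) => A) fun _ => h)
          ((⨁ (fun _ : Fin (n + 1) => A)).dim - 1) x y := fun x y => by
    rw [← hT (polarizationPairingOne (⨁ (fun _ : Fin (n + 1) => A)).X
          (sumPolarizationClass (fun _ : Fin (n + 1) => A) fun _ => h) ((⨁ (fun _ : Fin (n + 1) => A)).dim - 1) x y),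
      map_polarizationPairingOne, hσD]
  rw [hi a, hi b, key]

/-! ### §4 `M_{n+1}(ℚ) ⊆ B`: the matrix units are generated by Rosati-symmetric ones -/

/-- **The coordinate projector `e_{aa} = πₐ ≫ ιₐ` is Rosati-symmetric**: `(πₐ ≫ ιₐ)^* ∈ S_D ⊗ ℂ` on `A^{n+1}`
(`Q_D((πₐ ≫ ιₐ)^* x, y) = Q_D(πₐ^* xₐ, πₐ^* yₐ) = Q_D(x, (πₐ ≫ ιₐ)^* y)` by the block form).
[cite: MoonenZarhin1998WeilClasses, §1 (S_λ; chunk p0002 L54–L58)] [cite: Milne1999LefschetzClasses, §1 p. 643]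
[cite: LangeBirkenhake1992, §5.1 and §5.3] -/
theorem pullbackOne_π_comp_ι_self_mem_symmetricPullbackSpan (hA : 0 < A.dim) (a : Fin (n + 1)) :
    pullbackOne (⨁ (fun _ : Fin (n + 1) => A))
      (biproduct.π (fun _ : Fin (n + 1) => A) a ≫ biproduct.ι (fun _ : Fin (n + 1) => A) a) ∈ symmetricPullbackSpan
      (⨁ (fun _ : Fin (n + 1) => A)) (sumPolarizationClass (fun _ : Fin (n + 1) => A) fun _ => h) := by
  refine ⟨Submodule.subset_span ⟨_, rfl⟩, fun x y => ?_⟩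
  rw [pullbackOne_π_comp_ι_apply, pullbackOne_π_comp_ι_apply, polarizationPairingOne_sum_map_π_left hA,
    polarizationPairingOne_sum_map_π_right hA a x]

/-- **The symmetrised matrix unit `e_{ab} + e_{ba}` is Rosati-symmetric**: `(πₐ ≫ ι_b + π_b ≫ ιₐ)^* ∈ S_D ⊗ ℂ`
(uses that the diagonal blocks of `Q_D` coincide, `polarizationPairingOne_sum_map_π_map_π_eq_of_const`; the Rosati
involution of `λ^{n+1}` on `M_{n+1}(End⁰ A)` is «conjugate-transpose»).
[cite: MoonenZarhin1998WeilClasses, §1 (S_λ; chunk p0002 L54–L58)] [cite: Milne1999LefschetzClasses, §1 p. 643]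
[cite: LangeBirkenhake1992, §5.1 and §5.3] -/
theorem pullbackOne_π_comp_ι_add_mem_symmetricPullbackSpan (hA : 0 < A.dim) (hh : h ∈ hodgeClassSpan A.dim A.X 1)
    (htop : lefschetzPow h (A.dim - 1) 2 h ≠ 0)
    (hnd : ∀ x : complexBetti A.X 1, (∀ y, polarizationPairingOne A.X h (A.dim - 1) x y = 0) → x = 0)
    (a b : Fin (n + 1)) :
    pullbackOne (⨁ (fun _ : Fin (n + 1) => A))
      (biproduct.π (fun _ : Fin (n + 1) => A) a ≫ biproduct.ι (fun _ : Fin (n + 1) => A) b + biproduct.π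
        (fun _ : Fin (n + 1) => A) b ≫ biproduct.ι (fun _ : Fin (n + 1) => A) a) ∈
      symmetricPullbackSpan (⨁ (fun _ : Fin (n + 1) => A))
          (sumPolarizationClass (fun _ : Fin (n + 1) => A) fun _ => h) := by
  refine ⟨Submodule.subset_span ⟨_, rfl⟩, fun x y => ?_⟩
  have hadd : ∀ z : complexBetti (⨁ (fun _ : Fin (n + 1) => A)).X 1,
      pullbackOne (⨁ (fun _ : Fin (n + 1) => A))
          (biproduct.π (fun _ : Fin (n + 1) => A) a ≫ biproduct.ι (fun _ : Fin (n + 1) => A) b + biproduct.π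
            (fun _ : Fin (n + 1) => A) b ≫ biproduct.ι (fun _ : Fin (n + 1) => A) a) z =
        complexBetti.map (biproduct.π (fun _ : Fin (n + 1) => A) a).hom.hom.hom 1
            (complexBetti.map (biproduct.ι (fun _ : Fin (n + 1) => A) b).hom.hom.hom 1 z) +
        complexBetti.map (biproduct.π (fun _ : Fin (n + 1) => A) b).hom.hom.hom 1
            (complexBetti.map (biproduct.ι (fun _ : Fin (n + 1) => A) a).hom.hom.hom 1 z) := by
    intro z
    rw [← pullbackOne_π_comp_ι_apply, ← pullbackOne_π_comp_ι_apply, ← LinearMap.add_apply]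
    change (complexBetti.map _ 1).hom z = _
    rw [complexBetti_map_add_one]
    rfl
  rw [hadd, hadd, map_add, LinearMap.add_apply, map_add,
    polarizationPairingOne_sum_map_π_left hA a
      (complexBetti.map (biproduct.ι (fun _ : Fin (n + 1) => A) b).hom.hom.hom 1 x) y,
    polarizationPairingOne_sum_map_π_left hA b
      (complexBetti.map (biproduct.ι (fun _ : Fin (n + 1) => A) a).hom.hom.hom 1 x) y,
    polarizationPairingOne_sum_map_π_right hA a x, polarizationPairingOne_sum_map_π_right hA b x,
    polarizationPairingOne_sum_map_π_map_π_eq_of_const hA hh htop hnd b a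
      (complexBetti.map (biproduct.ι (fun _ : Fin (n + 1) => A) a).hom.hom.hom 1 x)
          (complexBetti.map (biproduct.ι (fun _ : Fin (n + 1) => A) b).hom.hom.hom 1 y),
    polarizationPairingOne_sum_map_π_map_π_eq_of_const hA hh htop hnd b a
      (complexBetti.map (biproduct.ι (fun _ : Fin (n + 1) => A) b).hom.hom.hom 1 x)
          (complexBetti.map (biproduct.ι (fun _ : Fin (n + 1) => A) a).hom.hom.hom 1 y)]
  exact add_comm _ _

/-- **`M_{n+1}(ℚ) ⊆ B ⊗ ℂ`: every matrix unit `(πₐ ≫ ι_b)^*` lies in the algebra generated by `S_D ⊗ ℂ`**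
(`e_{ab} = e_{aa} (e_{ab} + e_{ba})` for `a ≠ b`). [cite: MoonenZarhin1998WeilClasses, §1 (B := the subalgebra generated
by S_λ; chunk p0002 L58–L66)] [cite: Milne1999LefschetzClasses, §1 p. 643] -/
theorem pullbackOne_π_comp_ι_mem_adjoin_symmetricPullbackSpan (hA : 0 < A.dim) (hh : h ∈ hodgeClassSpan A.dim A.X 1)
    (htop : lefschetzPow h (A.dim - 1) 2 h ≠ 0)
    (hnd : ∀ x : complexBetti A.X 1, (∀ y, polarizationPairingOne A.X h (A.dim - 1) x y = 0) → x = 0)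
    (a b : Fin (n + 1)) :
    pullbackOne (⨁ (fun _ : Fin (n + 1) => A))
      (biproduct.π (fun _ : Fin (n + 1) => A) a ≫ biproduct.ι (fun _ : Fin (n + 1) => A) b) ∈
      Algebra.adjoin ℂ
          (symmetricPullbackSpan (⨁ (fun _ : Fin (n + 1) => A))
            (sumPolarizationClass (fun _ : Fin (n + 1) => A) fun _ => h) :
        Set (Module.End ℂ (complexBetti (⨁ (fun _ : Fin (n + 1) => A)).X 1))) := by
  by_cases hab : a = b
  · subst hab
    exact Algebra.subset_adjoin (pullbackOne_π_comp_ι_self_mem_symmetricPullbackSpan hA a)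
  · have he : biproduct.π (fun _ : Fin (n + 1) => A) a ≫ biproduct.ι (fun _ : Fin (n + 1) => A) b =
      (biproduct.π (fun _ : Fin (n + 1) => A) a ≫ biproduct.ι (fun _ : Fin (n + 1) => A) a) ≫
        (biproduct.π (fun _ : Fin (n + 1) => A) a ≫ biproduct.ι (fun _ : Fin (n + 1) => A) b + biproduct.π
              (fun _ : Fin (n + 1) => A) b ≫ biproduct.ι (fun _ : Fin (n + 1) => A) a) := by
      rw [Preadditive.comp_add, Category.assoc, biproduct.ι_π_self_assoc, Category.assoc,
        ← Category.assoc (biproduct.ι (fun _ : Fin (n + 1) => A) a) (biproduct.π (fun _ : Fin (n + 1) => A) b),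
            biproduct.ι_π_ne (fun _ : Fin (n + 1) => A) hab, Limits.zero_comp,
        Limits.comp_zero, add_zero]
    rw [he, pullbackOne_comp_eq_mul]
    exact Subalgebra.mul_mem _ (Algebra.subset_adjoin (pullbackOne_π_comp_ι_self_mem_symmetricPullbackSpan hA a))
      (Algebra.subset_adjoin (pullbackOne_π_comp_ι_add_mem_symmetricPullbackSpan hA hh htop hnd a b))

/-- **`F ⊆ B ⊗ ℂ` for `F` acting through integer matrices**: `φ^* ∈ B ⊗ ℂ` for every endomorphism `φ` of `A^{n+1}` of
matrix `α ∈ M_{n+1}(ℤ)`. [cite: MoonenZarhin1998WeilClasses, §1 Criterion (2) («F ⊆ B»; chunk p0003 L46–L70)]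
[cite: Milne1999LefschetzClasses, §1 p. 643] -/
theorem pullbackOne_mem_adjoin_symmetricPullbackSpan_of_matrix (hA : 0 < A.dim) (hh : h ∈ hodgeClassSpan A.dim A.X 1)
    (htop : lefschetzPow h (A.dim - 1) 2 h ≠ 0)
    (hnd : ∀ x : complexBetti A.X 1, (∀ y, polarizationPairingOne A.X h (A.dim - 1) x y = 0) → x = 0)
    {φ : ⨁ (fun _ : Fin (n + 1) => A) ⟶ ⨁ (fun _ : Fin (n + 1) => A)} {α : Matrix (Fin (n + 1)) (Fin (n + 1)) ℤ}
    (hφ : ∀ i, φ ≫ biproduct.π (fun _ : Fin (n + 1) => A) i = ∑ j, α i j • biproduct.π (fun _ : Fin (n + 1) => A) j) :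
    pullbackOne (⨁ (fun _ : Fin (n + 1) => A)) φ ∈ Algebra.adjoin ℂ
      (symmetricPullbackSpan (⨁ (fun _ : Fin (n + 1) => A)) (sumPolarizationClass (fun _ : Fin (n + 1) => A) fun _ => h) :
        Set (Module.End ℂ (complexBetti (⨁ (fun _ : Fin (n + 1) => A)).X 1))) := by
  rw [pullbackOne_eq_sum_of_matrix hφ]
  exact Subalgebra.sum_mem _ fun i _ => Subalgebra.sum_mem _ fun j _ =>
    Subalgebra.smul_mem _ (pullbackOne_π_comp_ι_mem_adjoin_symmetricPullbackSpan hA hh htop hnd j i) _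

/-! ### §5 `W_F(A ⊗ F)` is decomposable, hence algebraic -/

/-- **WEIL CLASSES ON `A ⊗ F` ARE PRODUCTS OF DIVISOR CLASSES.** Let `A` be a complex abelian variety with a class
`h ∈ B¹(A) ⊗ ℂ`, `h^{dim A} ≠ 0`, `Q_h` non-degenerate (`0 < dim A`); let `X = A^{n+1}` carry the product class
`D = Σ πᵢ^* h`, and let `F = ℚ[T]/(P) ↪ M_{n+1}(ℚ) ⊆ End⁰(X)` act through an endomorphism `φ` of integer matrix `α`,
`P(α) = 0`, `P` monic irreducible of degree `n + 1` (so `dim_F V_X = 2 dim A`). Then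
`W_F ⊗ ℂ = ⊕_ρ ⋀^{2 dim A} V_ρ ≤ 𝒟^{dim A} ⊗ ℂ`: Moonen–Zarhin's Criterion (2) through the PROJECTION CRITERION
(`weilClassesField_le_divisorClassesSpan_of_symm_idempotent`) fed with `s = (π_{i₀} ≫ ι_{i₀})^*` — `F ⊆ B` by §4, and
`V_ρ = {Σ ℓᵢ πᵢ^* a}` is the graph of a row eigenvector `ℓ` of `α` with `ℓ_{i₀} ≠ 0`, on which `s` is injective with
`s(V_ρ) = π_{i₀}^* H¹(A) = s(H¹(X))`. The case «`Y` of Type 1 or 2, `F ⊆ B`: decomposable» of the print's Theorem for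
the `F`-structures coming from the multiplicity space. [cite: MoonenZarhin1998WeilClasses, §1 Criterion (2) and its
proof (chunk p0003 L46–L70), Theorem (chunk p0003 L60–L90)] [cite: Deligne1982HodgeCycles, §4 (4.4)–(4.5)]
[cite: Milne1999LefschetzClasses, §1 p. 643] -/
theorem weilClassesField_biproduct_le_divisorClassesSpan_of_matrix (hA : 0 < A.dim)
    (hh : h ∈ hodgeClassSpan A.dim A.X 1) (htop : lefschetzPow h (A.dim - 1) 2 h ≠ 0)
    (hnd : ∀ x : complexBetti A.X 1, (∀ y, polarizationPairingOne A.X h (A.dim - 1) x y = 0) → x = 0)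
    {P : Polynomial ℤ} (hPm : P.Monic) (hPe : P.natDegree = n + 1) (hPirr : Irreducible (P.map (Int.castRingHom ℚ)))
    {α : Matrix (Fin (n + 1)) (Fin (n + 1)) ℤ}
    (hα : Polynomial.eval₂ (Int.castRingHom (Matrix (Fin (n + 1)) (Fin (n + 1)) ℤ)) α P = 0)
    {φ : ⨁ (fun _ : Fin (n + 1) => A) ⟶ ⨁ (fun _ : Fin (n + 1) => A)}
    (hφ : ∀ i, φ ≫ biproduct.π (fun _ : Fin (n + 1) => A) i = ∑ j, α i j • biproduct.π (fun _ : Fin (n + 1) => A) j) :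
    weilClassesField (⨁ (fun _ : Fin (n + 1) => A)) φ P (2 * A.dim) ≤ divisorClassesSpan (⨁ (fun _ : Fin (n + 1) => A)).X
      (⨁ (fun _ : Fin (n + 1) => A)).dim A.dim := by
  obtain ⟨hhX, -, hndX⟩ := sumPolarizationClass_hypotheses (fun _ : Fin (n + 1) => A) (fun _ => h)
      (fun _ => hA) (fun _ => hh)
    (fun _ => htop) (fun _ => hnd)
  have hdim := dim_biproduct_const_succ A n
  have her : (n + 1) * (2 * A.dim) = 2 * (⨁ (fun _ : Fin (n + 1) => A)).dim := by rw [hdim]; ring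
  have hφP := biproduct_eval₂_eq_zero_of_matrix hφ hα
  -- a complex root `ρ` of `P`
  obtain ⟨ρ, hρ'⟩ : ∃ ρ : ℂ, (P.map (Int.castRingHom ℂ)).IsRoot ρ :=
    Complex.exists_root (natDegree_pos_iff_degree_pos.1 (by rw [hPm.natDegree_map, hPe]; exact Nat.succ_pos n))
  have hρ : Polynomial.eval₂ (Int.castRingHom ℂ) ρ P = 0 := by rw [← Polynomial.eval_map]; exact hρ'.eq_zero
  -- `V_ρ ≠ 0`, a row eigenvector `ℓ` with `ℓ_{i₀} ≠ 0`
  have hV : Module.End.eigenspace (pullbackOne (⨁ (fun _ : Fin (n + 1) => A)) φ) ρ ≠ ⊥ := by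
    intro hbot
    have e := finrank_eigenspace_eq_of_root hPm hPe hPirr hφP her hρ
    change Module.finrank ℂ (Module.End.eigenspace (pullbackOne (⨁ (fun _ : Fin (n + 1) => A)) φ) ρ) = 2 * A.dim at e
    rw [hbot, finrank_bot] at e
    omega
  obtain ⟨ℓ, ⟨i₀, hi₀⟩, hℓ⟩ := exists_rowEigenvector_of_eigenspace_ne_bot_of_matrix hφ hV
  -- the projector `s = (π_{i₀} ≫ ι_{i₀})^*`
  have hid : pullbackOne (⨁ (fun _ : Fin (n + 1) => A))
      (biproduct.π (fun _ : Fin (n + 1) => A) i₀ ≫ biproduct.ι (fun _ : Fin (n + 1) => A) i₀) *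
      pullbackOne (⨁ (fun _ : Fin (n + 1) => A))
          (biproduct.π (fun _ : Fin (n + 1) => A) i₀ ≫ biproduct.ι (fun _ : Fin (n + 1) => A) i₀) =
      pullbackOne (⨁ (fun _ : Fin (n + 1) => A))
          (biproduct.π (fun _ : Fin (n + 1) => A) i₀ ≫ biproduct.ι (fun _ : Fin (n + 1) => A) i₀) :=
    pullbackOne_mul_self_of_comp_eq (by rw [Category.assoc, biproduct.ι_π_self_assoc])
  have hs_u : ∀ a : complexBetti A.X 1,
      pullbackOne (⨁ (fun _ : Fin (n + 1) => A))
          (biproduct.π (fun _ : Fin (n + 1) => A) i₀ ≫ biproduct.ι (fun _ : Fin (n + 1) => A) i₀)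
          (∑ i, ℓ i • complexBetti.map (biproduct.π (fun _ : Fin (n + 1) => A) i).hom.hom.hom 1 a) =
        ℓ i₀ • complexBetti.map (biproduct.π (fun _ : Fin (n + 1) => A) i₀).hom.hom.hom 1 a := by
    intro a
    rw [pullbackOne_π_comp_ι_apply, map_sum, Finset.sum_eq_single i₀ (fun k _ hk => by
      rw [map_smul, map_ι_map_π_ne (fun _ : Fin (n + 1) => A) (Ne.symm hk), smul_zero])
            (fun h0 => absurd (Finset.mem_univ i₀) h0),
      map_smul, map_ι_map_π_self, map_smul]
  have hinj : ∀ x ∈ Module.End.eigenspace (pullbackOne (⨁ (fun _ : Fin (n + 1) => A)) φ) ρ,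
      pullbackOne (⨁ (fun _ : Fin (n + 1) => A))
          (biproduct.π (fun _ : Fin (n + 1) => A) i₀ ≫ biproduct.ι (fun _ : Fin (n + 1) => A) i₀) x = 0 → x = 0 := by
    intro x hx hx0
    obtain ⟨a, rfl⟩ := exists_eq_sum_smul_map_π_of_mem_eigenspace_of_matrix hφ hPm hPe hPirr hφP her hρ hℓ hi₀ hx
    rw [hs_u] at hx0
    have ha : complexBetti.map (biproduct.π (fun _ : Fin (n + 1) => A) i₀).hom.hom.hom 1 a = 0 :=
        (smul_eq_zero.1 hx0).resolve_left hi₀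
    have ha' : a = 0 := by rw [← map_ι_map_π_self (fun _ : Fin (n + 1) => A) i₀ a, ha, map_zero]
    rw [ha']
    exact Finset.sum_eq_zero fun i _ => by rw [map_zero, smul_zero]
  have hsurj : ∀ w : complexBetti (⨁ (fun _ : Fin (n + 1) => A)).X 1, ∃ v ∈ Module.End.eigenspace
      (pullbackOne (⨁ (fun _ : Fin (n + 1) => A)) φ) ρ,
      pullbackOne (⨁ (fun _ : Fin (n + 1) => A))
          (biproduct.π (fun _ : Fin (n + 1) => A) i₀ ≫ biproduct.ι (fun _ : Fin (n + 1) => A) i₀) v =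
        pullbackOne (⨁ (fun _ : Fin (n + 1) => A))
            (biproduct.π (fun _ : Fin (n + 1) => A) i₀ ≫ biproduct.ι (fun _ : Fin (n + 1) => A) i₀) w := by
    intro w
    refine ⟨∑ i, ℓ i • complexBetti.map (biproduct.π (fun _ : Fin (n + 1) => A) i).hom.hom.hom 1
      ((ℓ i₀)⁻¹ • complexBetti.map (biproduct.ι (fun _ : Fin (n + 1) => A) i₀).hom.hom.hom 1 w),
      sum_smul_map_π_mem_eigenspace_of_matrix hφ hℓ _, ?_⟩
    rw [hs_u, map_smul, smul_smul, mul_inv_cancel₀ hi₀, one_smul, pullbackOne_π_comp_ι_apply]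
  exact weilClassesField_le_divisorClassesSpan_of_symm_idempotent hPm hPe hPirr hφP her (Nat.pos_iff_ne_zero.1 hA) hhX
    hndX (pullbackOne_mem_adjoin_symmetricPullbackSpan_of_matrix hA hh htop hnd hφ) hρ
    (pullbackOne_π_comp_ι_self_mem_symmetricPullbackSpan hA i₀) hid hinj hsurj

/-- **… hence the Weil classes of `A ⊗ F` are ALGEBRAIC** (`𝒟 ⊗ ℂ ⊆` algebraic classes, Lefschetz (1,1)).
[cite: MoonenZarhin1998WeilClasses, Introduction (chunk p0001 L10–L18) and §1 Criterion (2) (chunk p0003 L46–L70)]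
[cite: VoisinHodgeI2002, Thm. 11.30] -/
theorem weilClassesField_biproduct_le_algebraicClasses_of_matrix (hA : 0 < A.dim)
    (hh : h ∈ hodgeClassSpan A.dim A.X 1) (htop : lefschetzPow h (A.dim - 1) 2 h ≠ 0)
    (hnd : ∀ x : complexBetti A.X 1, (∀ y, polarizationPairingOne A.X h (A.dim - 1) x y = 0) → x = 0)
    {P : Polynomial ℤ} (hPm : P.Monic) (hPe : P.natDegree = n + 1) (hPirr : Irreducible (P.map (Int.castRingHom ℚ)))
    {α : Matrix (Fin (n + 1)) (Fin (n + 1)) ℤ}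
    (hα : Polynomial.eval₂ (Int.castRingHom (Matrix (Fin (n + 1)) (Fin (n + 1)) ℤ)) α P = 0)
    {φ : ⨁ (fun _ : Fin (n + 1) => A) ⟶ ⨁ (fun _ : Fin (n + 1) => A)}
    (hφ : ∀ i, φ ≫ biproduct.π (fun _ : Fin (n + 1) => A) i = ∑ j, α i j • biproduct.π (fun _ : Fin (n + 1) => A) j) :
    weilClassesField (⨁ (fun _ : Fin (n + 1) => A)) φ P (2 * A.dim) ≤ algebraicClasses
      (⨁ (fun _ : Fin (n + 1) => A)).X A.dim :=
  (weilClassesField_biproduct_le_divisorClassesSpan_of_matrix hA hh htop hnd hPm hPe hPirr hα hφ).trans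
    (AbelianVariety.divisorClassesSpan_le_algebraicClasses (⨁ (fun _ : Fin (n + 1) => A))
      (fun b hb hb' ↦ lefschetzOneOne_rational_holds
            (AbelianVariety.isSmoothProjective_holds (A := ⨁ (fun _ : Fin (n + 1) => A))) b hb hb') A.dim)

/-- **The same for `F = ℚ(α)`, `α ∈ M_{n+1}(ℤ)` with IRREDUCIBLE CHARACTERISTIC POLYNOMIAL, acting on `A^{n+1}` through
`φ_α = lift (i ↦ Σⱼ αᵢⱼ πⱼ)`** (Cayley–Hamilton: `χ_α(α) = 0`, `χ_α` monic of degree `n + 1`): `W_{ℚ(α)}(A^{n+1})` is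
spanned by products of divisor classes … [cite: MoonenZarhin1998WeilClasses, §1 Criterion (2) (chunk p0003 L46–L70)]
[cite: Deligne1982HodgeCycles, §4 (4.4)–(4.5)] -/
theorem weilClassesField_biproduct_le_divisorClassesSpan_of_irreducible_charpoly (hA : 0 < A.dim)
    (hh : h ∈ hodgeClassSpan A.dim A.X 1) (htop : lefschetzPow h (A.dim - 1) 2 h ≠ 0)
    (hnd : ∀ x : complexBetti A.X 1, (∀ y, polarizationPairingOne A.X h (A.dim - 1) x y = 0) → x = 0)
    {α : Matrix (Fin (n + 1)) (Fin (n + 1)) ℤ} (hirr : Irreducible (α.charpoly.map (Int.castRingHom ℚ))) :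
    weilClassesField (⨁ (fun _ : Fin (n + 1) => A))
      (biproduct.lift fun i => ∑ j, α i j • biproduct.π (fun _ : Fin (n + 1) => A) j) α.charpoly (2 * A.dim) ≤
      divisorClassesSpan (⨁ (fun _ : Fin (n + 1) => A)).X (⨁ (fun _ : Fin (n + 1) => A)).dim A.dim :=
  weilClassesField_biproduct_le_divisorClassesSpan_of_matrix hA hh htop hnd (Matrix.charpoly_monic α)
    (by rw [Matrix.charpoly_natDegree_eq_dim, Fintype.card_fin]) hirr
    (by have e := Matrix.aeval_self_charpoly α
        rwa [Polynomial.aeval_def, RingHom.eq_intCast' (algebraMap ℤ (Matrix (Fin (n + 1)) (Fin (n + 1)) ℤ))] at e)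
    (biproduct_lift_sum_zsmul_π_comp_π α)

/-- … and is contained in the algebraic classes. [cite: MoonenZarhin1998WeilClasses, Introduction (chunk p0001 L10–L18)]
[cite: VoisinHodgeI2002, Thm. 11.30] -/
theorem weilClassesField_biproduct_le_algebraicClasses_of_irreducible_charpoly (hA : 0 < A.dim)
    (hh : h ∈ hodgeClassSpan A.dim A.X 1) (htop : lefschetzPow h (A.dim - 1) 2 h ≠ 0)
    (hnd : ∀ x : complexBetti A.X 1, (∀ y, polarizationPairingOne A.X h (A.dim - 1) x y = 0) → x = 0)
    {α : Matrix (Fin (n + 1)) (Fin (n + 1)) ℤ} (hirr : Irreducible (α.charpoly.map (Int.castRingHom ℚ))) :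
    weilClassesField (⨁ (fun _ : Fin (n + 1) => A))
      (biproduct.lift fun i => ∑ j, α i j • biproduct.π (fun _ : Fin (n + 1) => A) j) α.charpoly (2 * A.dim) ≤
      algebraicClasses (⨁ (fun _ : Fin (n + 1) => A)).X A.dim :=
  weilClassesField_biproduct_le_algebraicClasses_of_matrix hA hh htop hnd (Matrix.charpoly_monic α)
    (by rw [Matrix.charpoly_natDegree_eq_dim, Fintype.card_fin]) hirr
    (by have e := Matrix.aeval_self_charpoly α
        rwa [Polynomial.aeval_def, RingHom.eq_intCast' (algebraMap ℤ (Matrix (Fin (n + 1)) (Fin (n + 1)) ℤ))] at e)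
    (biproduct_lift_sum_zsmul_π_comp_π α)

/-! ### §6 (rider) `(A ⊗ F, F)` is of WEIL TYPE: the multiplicity of every embedding is `dim A` -/

/-- Pull-back along a homomorphism of abelian varieties preserves `H^{1,0}` (restated from the `where` clause of
`Deligne1982.eigenMultiplicity_eq_of_companion`). [cite: VoisinHodgeI2002, §7.3.2] -/
private theorem map_mem_hodgeOneZero_of_hom' {B C : AbelianVariety ℂ} (f : B ⟶ C) {x : complexBetti C.X 1}
    (hx : x ∈ hodgeOneZero (AbelianVariety.isSmoothProjective_holds (A := C))) :
    complexBetti.map f.hom.hom.hom 1 x ∈ hodgeOneZero (AbelianVariety.isSmoothProjective_holds (A := B)) :=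
  IsOfHodgeType.map_of_isSmoothProjective hx AbelianVariety.isSmoothProjective_holds
    AbelianVariety.isSmoothProjective_holds f.hom.hom.hom

/-- **`(A ⊗ F, F)` IS OF WEIL TYPE: `n_ρ = dim (V_ρ ∩ H^{1,0}(A^{n+1})) = dim A` at EVERY complex root `ρ` of `P`** — half
of `dim V_ρ = 2 dim A`, so `n_σ = n_σ̄` for all `σ` (Moonen–Zarhin's condition (6) for `W_F` to consist of Hodge classes;
Deligne's (4.4) `a_σ = b_σ = d/2` at the point `A₀ ⊗ E`: «`H^{1,0}_σ(A₀ ⊗ E) = H^{1,0}(A₀) ⊗ σ`»), for the `F`-structure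
through ANY integer matrix `α` with `P(α) = 0`: `V_ρ = u_ℓ(H¹(A))` (§2) and `V_ρ ∩ H^{1,0} = u_ℓ(H^{1,0}(A))`, because the
pull-backs `πᵢ^*`, `ι_{i₀}^*` preserve Hodge types and `ι_{i₀}^* ∘ u_ℓ = ℓ_{i₀} · id`. The companion-matrix case on product
cones is the tree's `Deligne1982.eigenMultiplicity_eq_of_companion`. [cite: MoonenZarhin1998WeilClasses, §1 (6) and
«n_σ + n_σ' = 2g/[F:ℚ]» (chunk p0001 L70–L90)]
[cite: Deligne1982HodgeCycles, §4 Prop. 4.4 and proof of Thm. 4.8 (a), (b)] -/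
theorem eigenMultiplicity_biproduct_eq_dim_of_matrix (hA : 0 < A.dim)
    {P : Polynomial ℤ} (hPm : P.Monic) (hPe : P.natDegree = n + 1) (hPirr : Irreducible (P.map (Int.castRingHom ℚ)))
    {α : Matrix (Fin (n + 1)) (Fin (n + 1)) ℤ}
    (hα : Polynomial.eval₂ (Int.castRingHom (Matrix (Fin (n + 1)) (Fin (n + 1)) ℤ)) α P = 0)
    {φ : ⨁ (fun _ : Fin (n + 1) => A) ⟶ ⨁ (fun _ : Fin (n + 1) => A)}
    (hφ : ∀ i, φ ≫ biproduct.π (fun _ : Fin (n + 1) => A) i = ∑ j, α i j • biproduct.π (fun _ : Fin (n + 1) => A) j)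
    {ρ : ℂ} (hρ : Polynomial.eval₂ (Int.castRingHom ℂ) ρ P = 0) :
    eigenMultiplicity (⨁ (fun _ : Fin (n + 1) => A)) φ ρ = A.dim := by
  classical
  haveI := finite_complexBetti_abelianVariety (⨁ (fun _ : Fin (n + 1) => A)) 1
  haveI := finite_complexBetti_abelianVariety A 1
  have hXA : IsSmoothProjective A.dim A.X := AbelianVariety.isSmoothProjective_holds (A := A)
  have her : (n + 1) * (2 * A.dim) = 2 * (⨁ (fun _ : Fin (n + 1) => A)).dim := by
    rw [dim_biproduct_const_succ A n]; ring
  have hφP := biproduct_eval₂_eq_zero_of_matrix hφ hα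
  have hV : Module.End.eigenspace (pullbackOne (⨁ (fun _ : Fin (n + 1) => A)) φ) ρ ≠ ⊥ := by
    intro hbot
    have e := finrank_eigenspace_eq_of_root hPm hPe hPirr hφP her hρ
    change Module.finrank ℂ (Module.End.eigenspace (pullbackOne (⨁ (fun _ : Fin (n + 1) => A)) φ) ρ) = 2 * A.dim at e
    rw [hbot, finrank_bot] at e
    omega
  obtain ⟨ℓ, ⟨i₀, hi₀⟩, hℓ⟩ := exists_rowEigenvector_of_eigenspace_ne_bot_of_matrix hφ hV
  set L : complexBetti A.X 1 →ₗ[ℂ] complexBetti (⨁ (fun _ : Fin (n + 1) => A)).X 1 :=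
    ∑ i, ℓ i • (complexBetti.map (biproduct.π (fun _ : Fin (n + 1) => A) i).hom.hom.hom 1).hom with hL
  have hLapply : ∀ a,
      L a = ∑ i, ℓ i • complexBetti.map (biproduct.π (fun _ : Fin (n + 1) => A) i).hom.hom.hom 1 a := by
    intro a
    simp only [hL, LinearMap.sum_apply, LinearMap.smul_apply]
  have hsec : ∀ a, complexBetti.map (biproduct.ι (fun _ : Fin (n + 1) => A) i₀).hom.hom.hom 1 (L a) = ℓ i₀ • a := by
    intro a
    rw [hLapply, map_sum, Finset.sum_eq_single i₀ (fun k _ hk => by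
      rw [map_smul, map_ι_map_π_ne (fun _ : Fin (n + 1) => A) (Ne.symm hk), smul_zero])
      (fun h0 => absurd (Finset.mem_univ i₀) h0), map_smul, map_ι_map_π_self]
  have hinj : Function.Injective L := fun a b hab => by
    have e := congrArg (complexBetti.map (biproduct.ι (fun _ : Fin (n + 1) => A) i₀).hom.hom.hom 1) hab
    rw [hsec, hsec] at e
    exact smul_right_injective _ hi₀ e
  -- `V_ρ ∩ H^{1,0}(X) = L (H^{1,0}(A))`
  have hcap : Module.End.eigenspace (complexBetti.map φ.hom.hom.hom 1).hom ρ ⊓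
      hodgeOneZero (AbelianVariety.isSmoothProjective_holds (A := ⨁ (fun _ : Fin (n + 1) => A))) =
      (hodgeOneZero hXA).map L := by
    apply le_antisymm
    · rintro y ⟨hyV, hy10⟩
      obtain ⟨a, rfl⟩ := exists_eq_sum_smul_map_π_of_mem_eigenspace_of_matrix hφ hPm hPe hPirr hφP her hρ hℓ hi₀ hyV
      refine ⟨a, ?_, hLapply a⟩
      have ha : a = (ℓ i₀)⁻¹ • complexBetti.map (biproduct.ι (fun _ : Fin (n + 1) => A) i₀).hom.hom.hom 1 (L a) := by
        rw [hsec, smul_smul, inv_mul_cancel₀ hi₀, one_smul]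
      rw [ha]
      refine Submodule.smul_mem _ _ (map_mem_hodgeOneZero_of_hom' _ ?_)
      rw [hLapply]
      exact hy10
    · rintro _ ⟨a, ha, rfl⟩
      refine ⟨?_, ?_⟩
      · change L a ∈ Module.End.eigenspace (pullbackOne (⨁ (fun _ : Fin (n + 1) => A)) φ) ρ
        rw [hLapply]
        exact sum_smul_map_π_mem_eigenspace_of_matrix hφ hℓ a
      · change L a ∈ hodgeOneZero _
        rw [hLapply]
        exact Submodule.sum_mem _ fun i _ => Submodule.smul_mem _ _ (map_mem_hodgeOneZero_of_hom' _ ha)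
  rw [eigenMultiplicity, hcap]
  exact (LinearEquiv.finrank_eq (Submodule.equivMapOfInjective L hinj _)).symm.trans
    (AbelianVariety.finrank_hodgeOneZero_eq_dim A hXA)

/-- **… for `F = ℚ(α)` with irreducible characteristic polynomial acting through `φ_α = lift (i ↦ Σⱼ αᵢⱼ πⱼ)`**: every
embedding of `ℚ(α)` has multiplicity `dim A` on `H^{1,0}(A^{n+1})`. [cite: MoonenZarhin1998WeilClasses, §1 (6)]
[cite: Deligne1982HodgeCycles, §4 Prop. 4.4] -/
theorem eigenMultiplicity_biproduct_eq_dim_of_irreducible_charpoly (hA : 0 < A.dim)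
    {α : Matrix (Fin (n + 1)) (Fin (n + 1)) ℤ} (hirr : Irreducible (α.charpoly.map (Int.castRingHom ℚ)))
    {ρ : ℂ} (hρ : Polynomial.eval₂ (Int.castRingHom ℂ) ρ α.charpoly = 0) :
    eigenMultiplicity (⨁ (fun _ : Fin (n + 1) => A))
      (biproduct.lift fun i => ∑ j, α i j • biproduct.π (fun _ : Fin (n + 1) => A) j) ρ = A.dim :=
  eigenMultiplicity_biproduct_eq_dim_of_matrix hA (Matrix.charpoly_monic α)
    (by rw [Matrix.charpoly_natDegree_eq_dim, Fintype.card_fin]) hirr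
    (by have e := Matrix.aeval_self_charpoly α
        rwa [Polynomial.aeval_def, RingHom.eq_intCast' (algebraMap ℤ (Matrix (Fin (n + 1)) (Fin (n + 1)) ℤ))] at e)
    (biproduct_lift_sum_zsmul_π_comp_π α) hρ

end TensorNumberField

end Literature.AlgebraicGeometry.HodgeTheory

end
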